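import Literature.NumberTheory.EllipticCurves.CoatesGreenberg1996.GoodModelKernelH1Trivial
import Literature.NumberTheory.EllipticCurves.UnramifiedCoboundaryInputs
import HarnessLib

/-!
# The good-model transport `Φ_C` of the Coates–Greenberg record: coordinate action of the
# `C`-fixing Galois elements, Hensel lifts of the parameter over `K̄_v`, completeness of the
# finite layers (inputs of the almost-étale engine `GoodModelFormalH1AlmostEtale`)

HONEST FRAMING (BSD rank-`≤ 1` residual cell `b2b-bsdres`, home
`run/shared/lean/b2b/bsd-rank1-residual/`, team n1011, seat n1011-p05 GEN 9, row T-CG-DR, skeleton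
`cells/n1011/skel/T-CG-DR.md`): the cell deletes the COMBINATION-SHAPED residual classes of the
rank-`≤ 1` BSD formula from PUBLISHED theorems only and TYPES the construction-shaped ones;
research route, no claim beyond the stated classes, census output = EVIDENCE, nothing booked, no
mark moves. TOOL file (theorems only, no definition, no named fact): the three local inputs with
which the END `GoodModelKernelH1OfDeeplyRamified` feeds the abstract engine
`AlmostEtale.exists_forall_eq_sub_of_cocycle_of_trace` in order to DERIVE the record
`CoatesGreenberg1996.H1_goodModelKernel_trivial` (A254) from the trace form of "deeply ramified".

## Contents

* §1 `exists_mem_kernel_zCoord_eq_of_isAlgClosed` — over an ALGEBRAICALLY CLOSED valued field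
  `(L, w)` every `a` with `|a| < 1` is the parameter `z = -x/y` of a point of the kernel of
  reduction `E₁` of a `w`-integral elliptic Weierstrass equation `V/L` (Silverman VII.2.2; Hensel in
  the henselian ring `𝒪_w`, `henselianLocalRing_integer`; transcription of the tree's
  `exists_mem_kernel_zCoord_eq` of `UnramifiedCoboundaryInputs` — which is stated for a base change
  from `K_v` — to an arbitrary integral `V`, needed because the good model `W₀ ⊗ K̄_v` is NOT
  defined over `K_v`); `eq_of_mem_kernel_of_zCoord_eq` — `z` is injective on `E₁`.
* §2 `exists_limit_of_finiteDimensional` — a finite layer `Kn ⊆ K̄_v` over `K_v` is complete for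
  the spectral valuation: sequences with `|x_{r+1} - x_r| ≤ θ^{r+1}` (`θ < 1`) converge in `Kn`
  (`spectralNorm.completeSpace`; the tree's `exists_limit_of_mem_adjoin` for `K_v(ζ)` verbatim,
  with `K_v(ζ)` replaced by any finite-dimensional intermediate field).
* §3 The transport `Φ_C P = congrEquiv hW₀ (pointEquiv _ C (congrEquiv _ P))` of the record
  (`E(K̄_v) → W₀(K̄_v)`, `W₀ ⊗ K̄_v = C • E ⊗ K̄_v`): for `σ ∈ Γ_{K_v}` FIXING `C`,
  `Φ_C(σ • P)` is `σ` applied to the coordinates of `Φ_C(P)` (`transport_smul_of_eq_some`,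
  `transport_smul_eq_zero_iff`); the substitution formulas `σ (C.toX x) = C.toX (σ x)`,
  `σ (C.toY x y) = C.toY (σ x) (σ y)`.

References: J. H. Silverman, *AEC* 2nd ed. III.1 (Table 3.1), IV.1, VII.2.1–2.2
[SilvermanAEC2009]; J. Neukirch, *ANT* II (4.6), (6.x) (Hensel; henselian valued fields)
[NeukirchANT1999]; tree: `FormalGroupChart` (`approxRoot`, `monic_cubic_eval`, `equation_of_root`,
`one_lt_val_of_root`, `eq_of_z_eq`), `ReductionInertiaInvarianceProofs`
(`henselianLocalRing_integer`), `UnramifiedLayerRootsProofs` (`exists_limit_of_mem_adjoin`),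
`SelmerFiniteProofs` (`congrEquiv_smul`), `VariableChangePoints` (`pointEquiv_some`, `toX_def`,
`toY_def`).
-/

noncomputable section

open scoped Classical NNReal

open WeierstrassCurve Polynomial

universe u

namespace Summit.BirchSwinnertonDyer.Rank1Residual.Additive.GoodModelLine.KernelH1

open Literature.NumberTheory.EllipticCurves Literature.NumberTheory.EllipticCurves.FormalGroupChart

/-! ## §1 Points of `E₁` with prescribed parameter over an algebraically closed valued field -/

section Hensel

variable {L : Type u} [Field L] {w : Valuation L ℝ≥0} {V : WeierstrassCurve L}
  [hV : V.IsIntegral w.integer]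

/-- **`z` is injective on `E₁`**: two points of the kernel of reduction with the same parameter
coincide (`|z(P - Q)| = |z P - z Q|` and `z = 0` only at `O` on `E₁`). [folklore] -/
theorem eq_of_mem_kernel_of_zCoord_eq {P Q : V.toAffine.Point} (hP : P ∈ kernel w V)
    (hQ : Q ∈ kernel w V) (h : P.zCoord = Q.zCoord) : P = Q := by
  have h1 : w (P - Q).zCoord = 0 := by rw [← val_zCoord_sub hP hQ, h, sub_self, map_zero]
  have h2 : (P - Q).zCoord = 0 := (Valuation.zero_iff w).mp h1
  exact sub_eq_zero.mp ((zCoord_eq_zero_iff ((kernel w V).sub_mem hP hQ)).mp h2)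

variable [IsAlgClosed L] [V.IsElliptic]

/-- **`z : E₁(L) → 𝔪_L` is onto for `L` algebraically closed** (Silverman, *AEC* Prop. VII.2.2,
surjectivity half of `E₁ ≅ Ê(𝔪)`): every `a ∈ L` with `|a| < 1` is the parameter of a point
`P = (-a y, y) ∈ E₁(L)` of the `w`-integral elliptic equation `V`, where `Y = a³ y` is the Hensel
root `≡ -(1 - a₁a - a₂a²)` of the monic cubic `Y³ + (1 - a₁a - a₂a²)Y² + (a₃ + a₄a)a³Y - a₆a⁶`
(`approxRoot`, `monic_cubic_eval`, `equation_of_root`, `one_lt_val_of_root`; `𝒪_w` is henselian,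
`henselianLocalRing_integer`). Transcription of the tree's `exists_mem_kernel_zCoord_eq` (stated for
a base change from `K_v`) to an arbitrary integral `V/L`.
[cite: SilvermanAEC2009, Prop. VII.2.2 (PDF p. 191) and IV.1] -/
theorem exists_mem_kernel_zCoord_eq_of_isAlgClosed {a : L} (ha : w a < 1) :
    ∃ P ∈ kernel w V, P.zCoord = a := by
  by_cases ha0 : a = 0
  · exact ⟨0, (kernel w V).zero_mem, by rw [WeierstrassCurve.Affine.Point.zCoord_zero, ha0]⟩
  have ha0' : 0 < w a := (Valuation.pos_iff w).mpr ha0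
  have hvw : w.Integers w.integer := Valuation.integer.integers w
  haveI := henselianLocalRing_integer w
  have ha1 : w a ≤ 1 := ha.le
  have ha₃ : w V.a₃ ≤ 1 := val_a₃_le_one
  have ha₄ : w V.a₄ ≤ 1 := val_a₄_le_one
  have ha₆ : w V.a₆ ≤ 1 := val_a₆_le_one
  -- the coefficients of the monic cubic
  set u : L := 1 - V.a₁ * a - V.a₂ * a ^ 2 with hu
  set c : L := (V.a₃ + V.a₄ * a) * a ^ 3 with hc
  set d : L := V.a₆ * a ^ 6 with hd
  obtain ⟨hu1, happ, huniq⟩ := approxRoot (V := V) (w := w) ha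
  have hu_le : w u ≤ 1 := hu1.le
  have hca : w c ≤ w a ^ 3 := by
    rw [hc, map_mul, map_pow]
    refine mul_le_of_le_one_left zero_le ?_
    refine (Valuation.map_add w _ _).trans (max_le ha₃ ?_)
    rw [map_mul]; exact mul_le_one' ha₄ ha1
  have ha3lt : w a ^ 3 < 1 := pow_lt_one₀ zero_le ha three_ne_zero
  have hc1 : w c ≤ 1 := hca.trans ha3lt.le
  have hd1 : w d ≤ 1 := by
    rw [hd, map_mul, map_pow]; exact mul_le_one' ha₆ (pow_le_one₀ zero_le ha1)
  -- integral lifts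
  set uR : w.integer := ⟨u, hu_le⟩ with huR
  set cR : w.integer := ⟨c, hc1⟩ with hcR
  set dR : w.integer := ⟨d, hd1⟩ with hdR
  have huRc : ((uR : w.integer) : L) = u := rfl
  have hcRc : ((cR : w.integer) : L) = c := rfl
  have hdRc : ((dR : w.integer) : L) = d := rfl
  -- the monic cubic over `𝒪_w` and its approximate root `-u`
  set f : (w.integer)[X] :=
    Polynomial.X ^ 3 + C uR * Polynomial.X ^ 2 + C cR * Polynomial.X - C dR with hf
  have hfmonic : f.Monic := by
    rw [hf, sub_eq_add_neg, add_assoc, add_assoc]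
    refine (monic_X_pow 3).add_of_left ?_
    refine (degree_add_le _ _).trans_lt (max_lt ?_ ((degree_add_le _ _).trans_lt (max_lt ?_ ?_)))
    · exact (degree_C_mul_X_pow_le 2 _).trans_lt (by rw [degree_X_pow]; norm_num)
    · exact (degree_C_mul_X_le _).trans_lt (by rw [degree_X_pow]; norm_num)
    · rw [degree_neg]; exact (degree_C_le).trans_lt (by rw [degree_X_pow]; norm_num)
  have hfeval : ∀ Y : w.integer, ((f.eval Y : w.integer) : L) =
      (Y : L) ^ 3 + u * (Y : L) ^ 2 + c * (Y : L) - d := by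
    intro Y
    change algebraMap w.integer L (f.eval Y) = _
    rw [hf]
    simp only [eval_add, eval_sub, eval_mul, eval_pow, eval_X, eval_C, map_add, map_sub, map_mul,
      map_pow]
    rfl
  have hfder : ∀ Y : w.integer, ((f.derivative.eval Y : w.integer) : L) =
      3 * (Y : L) ^ 2 + 2 * u * (Y : L) + c := by
    intro Y
    change algebraMap w.integer L (f.derivative.eval Y) = _
    have : f.derivative = 3 * Polynomial.X ^ 2 + 2 * C uR * Polynomial.X + C cR := by
      rw [hf]
      simp only [derivative_add, derivative_sub, derivative_X_pow, derivative_mul, derivative_C,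
        derivative_X, zero_mul, zero_add, mul_one, sub_zero, Nat.cast_ofNat, map_ofNat]
      ring
    rw [this]
    simp only [eval_add, eval_mul, eval_pow, eval_X, eval_C, eval_ofNat, map_add, map_mul, map_pow,
      map_ofNat]
    rfl
  set b₁ : w.integer := ⟨-u, by change w (-u) ≤ 1; rw [Valuation.map_neg]; exact hu_le⟩ with hb₁
  have hb₁c : ((b₁ : w.integer) : L) = -u := rfl
  have h₁ : f.eval b₁ ∈ IsLocalRing.maximalIdeal w.integer := by
    rw [← IsLocalRing.residue_eq_zero_iff, ← v_algebraMap_lt_one_iff hvw]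
    change w ((f.eval b₁ : w.integer) : L) < 1
    rw [hfeval, hb₁c]
    refine lt_of_le_of_lt (le_trans (le_of_eq ?_) happ) ha3lt
    rw [hu, hc, hd]
  have h₂ : IsUnit (f.derivative.eval b₁) := by
    rw [hvw.isUnit_iff_valuation_eq_one]
    change w ((f.derivative.eval b₁ : w.integer) : L) = 1
    rw [hfder, hb₁c, show (3 : L) * (-u) ^ 2 + 2 * u * -u + c = u ^ 2 + c by ring,
      Valuation.map_add_eq_of_lt_left]
    · rw [map_pow, hu1, one_pow]
    · rw [map_pow, hu1, one_pow]; exact hca.trans_lt ha3lt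
  obtain ⟨Y₀, hY₀root, hY₀cong⟩ := HenselianLocalRing.is_henselian f hfmonic b₁ h₁ h₂
  -- `|Y₀| = 1`
  have hY₀1 : w (Y₀ : L) = 1 := by
    refine huniq _ ?_
    have := hY₀cong
    rw [← IsLocalRing.residue_eq_zero_iff, ← v_algebraMap_lt_one_iff hvw] at this
    change w ((Y₀ : L) - (b₁ : L)) < 1 at this
    rwa [hb₁c, sub_neg_eq_add] at this
  -- the point
  have ha3 : a ^ 3 ≠ 0 := pow_ne_zero 3 ha0
  set y : L := (Y₀ : L) / a ^ 3 with hy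
  have hYy : (Y₀ : L) = y * a ^ 3 := by rw [hy, div_mul_cancel₀ _ ha3]
  have hrootL : (Y₀ : L) ^ 3 + u * (Y₀ : L) ^ 2 + c * (Y₀ : L) - d = 0 := by
    have h := congrArg (fun z : w.integer ↦ (z : L)) (show f.eval Y₀ = 0 from hY₀root)
    simp only [hfeval] at h
    simpa using h
  have hg : a ^ 3 * y ^ 3 + (1 - V.a₁ * a - V.a₂ * a ^ 2) * y ^ 2 + (V.a₃ + V.a₄ * a) * y - V.a₆
      = 0 := by
    have hm := monic_cubic_eval (V := V) a y
    rw [← hYy] at hm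
    have h6 : a ^ 6 * (a ^ 3 * y ^ 3 + (1 - V.a₁ * a - V.a₂ * a ^ 2) * y ^ 2 +
        (V.a₃ + V.a₄ * a) * y - V.a₆) = 0 := by
      rw [← hm, ← hrootL, hu, hc, hd]
    exact (mul_eq_zero.mp h6).resolve_left (pow_ne_zero 6 ha0)
  have heq : V.toAffine.Equation (-a * y) y := equation_of_root hg
  have hns : V.toAffine.Nonsingular (-a * y) y := (Affine.equation_iff_nonsingular).mp heq
  have hwy : w y * w a ^ 3 = 1 := by rw [← map_pow, ← map_mul, ← hYy, hY₀1]
  have hy0 : y ≠ 0 := by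
    intro h; rw [h, map_zero, zero_mul] at hwy; exact zero_ne_one hwy
  refine ⟨.some _ _ hns, some_mem_kernel hns (one_lt_val_of_root ha0' ha hwy), ?_⟩
  rw [WeierstrassCurve.Affine.Point.zCoord_some]
  field_simp

end Hensel

/-! ## §2 Completeness of a finite layer `Kn ⊆ K̄_v` for the spectral valuation -/

section Complete

open NumberField IsDedekindDomain

variable {K : Type u} [Field K] [NumberField K] {v : HeightOneSpectrum (𝓞 K)}
  {w : Valuation (AlgebraicClosure (v.adicCompletion K)) ℝ≥0}
  (hw : ∀ x, (w x : ℝ) =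
    spectralNorm (v.adicCompletion K) (AlgebraicClosure (v.adicCompletion K)) x)

include hw in
/-- **Completeness of a finite layer** `Kn ⊆ K̄_v` (`Kn/K_v` finite-dimensional) for the spectral
valuation: a sequence `(x_r)` in `Kn` with `|x_{r+1} - x_r|_v ≤ θ^{r+1}`, `θ < 1`, converges to
some `y ∈ Kn` with `|y - x_r|_v ≤ θ^{r+1}` (`Kn` is complete for the spectral norm, Mathlib
`spectralNorm.completeSpace`; the bound by the ultrametric inequality). The tree's
`exists_limit_of_mem_adjoin` (for `K_v(ζ)`), with the layer generalised. [folklore] -/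
theorem exists_limit_of_finiteDimensional
    (Kn : IntermediateField (v.adicCompletion K) (AlgebraicClosure (v.adicCompletion K)))
    [FiniteDimensional (v.adicCompletion K) Kn] {ρ : ℝ≥0} (hρ1 : ρ < 1) (x : ℕ → Kn)
    (hx : ∀ r, w ((x (r + 1) : AlgebraicClosure (v.adicCompletion K)) - x r) ≤ ρ ^ (r + 1)) :
    ∃ y : Kn, ∀ r, w ((y : AlgebraicClosure (v.adicCompletion K)) - x r) ≤ ρ ^ (r + 1) := by
  letI : NontriviallyNormedField (v.adicCompletion K) :=
    Valued.toNontriviallyNormedField (v.adicCompletion K) (WithZero (Multiplicative ℤ))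
  letI : NormedField Kn := spectralNorm.normedField (v.adicCompletion K) Kn
  haveI : CompleteSpace Kn := spectralNorm.completeSpace (v.adicCompletion K) Kn
  -- the norm on `Kn` is the spectral valuation
  have hnorm : ∀ z : Kn, ‖z‖ = (w (z : AlgebraicClosure (v.adicCompletion K)) : ℝ) := fun z ↦ by
    change spectralNorm (v.adicCompletion K) Kn z = _
    rw [hw, spectralNorm.eq_of_tower (L := AlgebraicClosure (v.adicCompletion K))]
    rfl
  -- the ultrametric estimate `|x_{r+k} - x_r| ≤ ρ^{r+1}`
  have hultra : ∀ r k, w ((x (r + k) : AlgebraicClosure (v.adicCompletion K)) - x r) ≤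
      ρ ^ (r + 1) := by
    intro r k
    induction k with
    | zero => rw [add_zero, sub_self, map_zero]; exact zero_le
    | succ k ih =>
      have e : (x (r + (k + 1)) : AlgebraicClosure (v.adicCompletion K)) - x r =
          ((x (r + k + 1) : AlgebraicClosure (v.adicCompletion K)) - x (r + k)) +
            ((x (r + k) : AlgebraicClosure (v.adicCompletion K)) - x r) := by
        rw [← add_assoc]; ring
      rw [e]
      refine (Valuation.map_add w _ _).trans (max_le ((hx (r + k)).trans ?_) ih)
      exact pow_le_pow_right_of_le_one' hρ1.le (by omega)
  -- Cauchy, hence convergent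
  have hcauchy : CauchySeq x := by
    refine cauchySeq_of_le_geometric (ρ : ℝ) (ρ : ℝ) (by exact_mod_cast hρ1) fun r ↦ ?_
    rw [dist_eq_norm, ← norm_neg, neg_sub, hnorm]
    push_cast
    rw [← pow_succ']
    exact_mod_cast hx r
  obtain ⟨y, hy⟩ := cauchySeq_tendsto_of_complete hcauchy
  refine ⟨y, fun r ↦ ?_⟩
  -- pass to the limit in `|x_{r+k} - x_r| ≤ ρ^{r+1}`
  have hshift : Filter.Tendsto (fun k ↦ x (k + r)) Filter.atTop (nhds y) :=
    hy.comp (Filter.tendsto_add_atTop_nat r)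
  have hlim : Filter.Tendsto (fun k ↦ ‖x (k + r) - x r‖) Filter.atTop (nhds ‖y - x r‖) :=
    (hshift.sub_const (x r)).norm
  have hle : ‖y - x r‖ ≤ (ρ : ℝ) ^ (r + 1) := by
    refine le_of_tendsto hlim (Filter.Eventually.of_forall fun k ↦ ?_)
    rw [hnorm, add_comm k r]
    push_cast
    exact_mod_cast hultra r k
  rw [hnorm] at hle
  push_cast at hle
  exact_mod_cast hle

end Complete

/-! ## §3 The transport `Φ_C` and the Galois elements fixing `C` -/

section Transport

open NumberField IsDedekindDomain Field Literature.NumberTheory.GaloisRepresentations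

variable {K : Type u} [Field K] [NumberField K] (W : WeierstrassCurve K)
  (v : HeightOneSpectrum (𝓞 K)) {w : Valuation (AlgebraicClosure (v.adicCompletion K)) ℝ≥0}
  (C : VariableChange (AlgebraicClosure (v.adicCompletion K)))
  {W₀ : WeierstrassCurve w.integer}
  (hW₀ : C • (W.baseChange (v.adicCompletion K)).baseChange (AlgebraicClosure (v.adicCompletion K)) =
    W₀.baseChange (AlgebraicClosure (v.adicCompletion K)))

/-- The substitution `x ↦ u⁻²(x - r)` commutes with a ring endomorphism fixing `C`.
[cite: SilvermanAEC2009, III.1 Table 3.1] -/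
theorem apply_toX_of_map_eq {R : Type*} [CommRing R] (D : VariableChange R) (f : R →+* R)
    (hf : D.map f = D) (x : R) : f (D.toX x) = D.toX (f x) := by
  have hu : f (↑D.u⁻¹ : R) = ↑D.u⁻¹ := by
    have h := congrArg (fun D' : VariableChange R ↦ ((D'.u⁻¹ : Rˣ) : R)) hf
    simp only [VariableChange.map, Units.coe_map_inv, MonoidHom.coe_coe] at h
    exact h
  have hr : f D.r = D.r := by
    have h := congrArg VariableChange.r hf
    simpa only [VariableChange.map] using h
  rw [VariableChange.toX_def, VariableChange.toX_def, map_mul, map_pow, map_sub, hu, hr]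

/-- The substitution `y ↦ u⁻³(y - s(x - r) - t)` commutes with a ring endomorphism fixing `C`.
[cite: SilvermanAEC2009, III.1 Table 3.1] -/
theorem apply_toY_of_map_eq {R : Type*} [CommRing R] (D : VariableChange R) (f : R →+* R)
    (hf : D.map f = D) (x y : R) : f (D.toY x y) = D.toY (f x) (f y) := by
  have hu : f (↑D.u⁻¹ : R) = ↑D.u⁻¹ := by
    have h := congrArg (fun D' : VariableChange R ↦ ((D'.u⁻¹ : Rˣ) : R)) hf
    simp only [VariableChange.map, Units.coe_map_inv, MonoidHom.coe_coe] at h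
    exact h
  have hr : f D.r = D.r := by
    have h := congrArg VariableChange.r hf
    simpa only [VariableChange.map] using h
  have hs : f D.s = D.s := by
    have h := congrArg VariableChange.s hf
    simpa only [VariableChange.map] using h
  have ht : f D.t = D.t := by
    have h := congrArg VariableChange.t hf
    simpa only [VariableChange.map] using h
  rw [VariableChange.toY_def, VariableChange.toY_def, map_mul, map_pow, map_sub, map_sub, map_mul,
    map_sub, hu, hr, hs, ht]

/-- **The transport `Φ_C` on affine points.** For `Q = (x₁, y₁)` on `(E ⊗ K_v) ⊗ K̄_v`,
`congrEquiv hW₀ (pointEquiv _ C Q) = (C.toX x₁, C.toY x₁ y₁)` on the good model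
`W₀ ⊗ K̄_v = C • E ⊗ K̄_v`. [cite: SilvermanAEC2009, III.1 Table 3.1] -/
theorem transport_some {x₁ y₁ : AlgebraicClosure (v.adicCompletion K)}
    (h₁ : ((W.baseChange (v.adicCompletion K)).baseChange
      (AlgebraicClosure (v.adicCompletion K))).toAffine.Nonsingular x₁ y₁) :
    ∃ h', Affine.Point.congrEquiv hW₀ (VariableChange.pointEquiv _ C (Affine.Point.some x₁ y₁ h₁)) =
      Affine.Point.some (C.toX x₁) (C.toY x₁ y₁) h' :=
  ⟨_, by rw [VariableChange.pointEquiv_some, Affine.Point.congrEquiv_some]⟩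

/-- **`Φ_C` intertwines `σ` with the coordinate action, for `σ` fixing `C`.** If
`Φ_C(P) = (x, y)` then `Φ_C(σ • P) = (σ x, σ y)` (`σ ∈ Γ_{K_v}` with `C.map σ = C`;
`Φ_C P = congrEquiv hW₀ (pointEquiv _ C (congrEquiv _ P))` the transport of the record): `Φ_C(P)`
has coordinates `(C.toX x₁, C.toY x₁ y₁)` for `P = (x₁, y₁)`, `σ • P = (σ x₁, σ y₁)`
(`congrEquiv_smul`), and `σ` commutes with the substitution (`apply_toX_of_map_eq`,
`apply_toY_of_map_eq`). [cite: SilvermanAEC2009, III.1 Table 3.1 and VIII.1] -/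
theorem transport_smul_of_eq_some (σ : absoluteGaloisGroup (v.adicCompletion K))
    (hσC : C.map ((absoluteGaloisGroup.toAlgEquiv (v.adicCompletion K) σ :
        AlgebraicClosure (v.adicCompletion K) ≃ₐ[v.adicCompletion K]
          AlgebraicClosure (v.adicCompletion K)) :
        AlgebraicClosure (v.adicCompletion K) →+* AlgebraicClosure (v.adicCompletion K)) = C)
    (P : localPoints W (v.adicCompletion K)) {x y : AlgebraicClosure (v.adicCompletion K)}
    {h : (W₀.baseChange (AlgebraicClosure (v.adicCompletion K))).toAffine.Nonsingular x y}
    (hP : Affine.Point.congrEquiv hW₀ (VariableChange.pointEquiv _ C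
        (Affine.Point.congrEquiv (baseChange_baseChange_adicCompletion W v).symm P)) =
      Affine.Point.some x y h) :
    ∃ h', Affine.Point.congrEquiv hW₀ (VariableChange.pointEquiv _ C
        (Affine.Point.congrEquiv (baseChange_baseChange_adicCompletion W v).symm (σ • P))) =
      Affine.Point.some (absoluteGaloisGroup.toAlgEquiv (v.adicCompletion K) σ x)
        (absoluteGaloisGroup.toAlgEquiv (v.adicCompletion K) σ y) h' := by
  set σ' : AlgebraicClosure (v.adicCompletion K) →+* AlgebraicClosure (v.adicCompletion K) :=
    ((absoluteGaloisGroup.toAlgEquiv (v.adicCompletion K) σ :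
        AlgebraicClosure (v.adicCompletion K) ≃ₐ[v.adicCompletion K]
          AlgebraicClosure (v.adicCompletion K)) :
        AlgebraicClosure (v.adicCompletion K) →+* AlgebraicClosure (v.adicCompletion K)) with hσ'
  rw [congrEquiv_smul]
  generalize hQ : Affine.Point.congrEquiv (baseChange_baseChange_adicCompletion W v).symm P = Q
  rw [hQ] at hP
  rcases Q with _ | ⟨x₁, y₁, h₁⟩
  · -- `Q = O`: then `Φ P = O ≠ some`
    exfalso
    rw [← WeierstrassCurve.Affine.Point.zero_def, map_zero, map_zero] at hP
    exact WeierstrassCurve.Affine.Point.some_ne_zero _ hP.symm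
  · obtain ⟨h₁', e₁⟩ := transport_some W v C hW₀ h₁
    rw [e₁] at hP
    simp only [WeierstrassCurve.Affine.Point.some.injEq] at hP
    obtain ⟨rfl, rfl⟩ := hP
    obtain ⟨h₂, hmap⟩ : ∃ h₂, Affine.Point.map
        ((absoluteGaloisGroup.toAlgEquiv (v.adicCompletion K) σ :
          AlgebraicClosure (v.adicCompletion K) ≃ₐ[v.adicCompletion K]
            AlgebraicClosure (v.adicCompletion K)) :
          AlgebraicClosure (v.adicCompletion K) →ₐ[v.adicCompletion K]
            AlgebraicClosure (v.adicCompletion K)) (Affine.Point.some x₁ y₁ h₁) =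
        Affine.Point.some (σ' x₁) (σ' y₁) h₂ :=
      ⟨_, by rw [Affine.Point.map_some]; rfl⟩
    rw [hmap]
    obtain ⟨h₃, e₃⟩ := transport_some W v C hW₀ h₂
    rw [e₃]
    have ex : C.toX (σ' x₁) = σ' (C.toX x₁) := (apply_toX_of_map_eq C σ' hσC x₁).symm
    have ey : C.toY (σ' x₁) (σ' y₁) = σ' (C.toY x₁ y₁) := (apply_toY_of_map_eq C σ' hσC x₁ y₁).symm
    exact ⟨ex ▸ ey ▸ h₃, point_some_eq_some ex ey⟩

/-- `Φ_C` is a bijection fixing `O`, so `Φ_C(σ • P) = O` iff `Φ_C(P) = O`. [folklore] -/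
theorem transport_smul_eq_zero_iff (σ : absoluteGaloisGroup (v.adicCompletion K))
    (P : localPoints W (v.adicCompletion K)) :
    Affine.Point.congrEquiv hW₀ (VariableChange.pointEquiv _ C
        (Affine.Point.congrEquiv (baseChange_baseChange_adicCompletion W v).symm (σ • P))) = 0 ↔
      Affine.Point.congrEquiv hW₀ (VariableChange.pointEquiv _ C
        (Affine.Point.congrEquiv (baseChange_baseChange_adicCompletion W v).symm P)) = 0 := by
  simp only [AddEquiv.map_eq_zero_iff]
  change σ • P = (0 : localPoints W (v.adicCompletion K)) ↔ P = (0 : localPoints W (v.adicCompletion K))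
  exact smul_eq_zero_iff_eq σ

end Transport

end Summit.BirchSwinnertonDyer.Rank1Residual.Additive.GoodModelLine.KernelH1

end
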